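import Mathlib
import Literature.RingTheory.Derivation.WronskianPurity
import HarnessLib

/-!
# Derivations of a radicial degree-`p` extension

Topic: `Literature/RingTheory/Derivation`. Let `R ⊆ S` be domains, `S` finite over `R` of rank
`p = char R` (prime), `R` an integrally closed UFD. For `θ ∈ S ∖ R` with `θ^p = h ∈ R`:
* `prime_X_pow_sub_C_of_forall_pow_ne`: `X^p - h` is prime in `R[X]` (Kummer + Gauss);
* `exists_derivation_apply_ne_zero`: `R[T]/(T^p - h) → S` is injective with `R`-torsion cokernel,
  and `d/dT` transports to an `R`-derivation `D` of `S` with `D θ ≠ 0`;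
* `exists_saturated_derivation`: dividing a non-zero derivation of the UFD `S` by the gcd of its
  values on an `R`-basis yields one whose values on the basis have no common prime factor.
Bricks of the rank-`p` Kimura–Niitsuma argument (Matsumura, *Commutative Ring Theory*, end of
§26).

References: H. Matsumura, *Commutative Ring Theory*, CUP 1986, §25–§26. Elementary; no named
facts.
-/

namespace Literature.RingTheory.Derivation

open Polynomial IsLocalRing Module

/-! ### 3. A saturated `R`-derivation of `S` -/

/-- `X^p - h` is prime over an integrally closed UFD when `h` is not a `p`-th power (Kummer
irreducibility over the fraction field plus Gauss's lemma). [folklore] -/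
theorem prime_X_pow_sub_C_of_forall_pow_ne {R : Type*} [CommRing R] [IsDomain R]
    [UniqueFactorizationMonoid R] [IsIntegrallyClosed R] {p : ℕ} (hp : p.Prime) {h : R}
    (hh : ∀ r : R, r ^ p ≠ h) : Prime ((X : R[X]) ^ p - C h) := by
  let K := FractionRing R
  have hmonic : ((X : R[X]) ^ p - C h).Monic := monic_X_pow_sub_C h hp.ne_zero
  have hirr : Irreducible ((X : R[X]) ^ p - C h) := by
    rw [hmonic.irreducible_iff_irreducible_map_fraction_map (K := K), Polynomial.map_sub,
      Polynomial.map_pow, map_X, map_C]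
    refine (X_pow_sub_C_irreducible_iff_of_prime hp).mpr fun b hb => ?_
    have hint : IsIntegral R b := by
      refine ⟨X ^ p - C h, hmonic, ?_⟩
      rw [eval₂_sub, eval₂_X_pow, eval₂_C, hb, sub_self]
    obtain ⟨r, hr⟩ := IsIntegrallyClosed.algebraMap_eq_of_integral hint
    refine hh r (IsFractionRing.injective R K ?_)
    rw [map_pow, hr, hb]
  exact UniqueFactorizationMonoid.irreducible_iff_prime.mp hirr

/-- **A non-zero `R`-derivation of `S`.** For `θ ∈ S ∖ R` with `θ^p = h ∈ R`, the map
`R[T]/(T^p - h) → S` is injective (incomparability) with `R`-torsion cokernel (rank count),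
and `d/dT` transports to an `R`-derivation `D` of `S` with `D θ ≠ 0`. [folklore] -/
theorem exists_derivation_apply_ne_zero {R S : Type*} [CommRing R] [IsDomain R]
    [UniqueFactorizationMonoid R] [IsIntegrallyClosed R] [CommRing S] [IsDomain S] [Algebra R S]
    [Module.Finite R S] [FaithfulSMul R S] {p : ℕ} [Fact p.Prime] [CharP R p]
    (hrank : finrank R S = p) {θ : S} (hθ : θ ∉ (algebraMap R S).range) {h : R}
    (hθh : θ ^ p = algebraMap R S h) : ∃ D : Derivation R S S, D θ ≠ 0 := by
  have hp : p.Prime := Fact.out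
  have hinj := FaithfulSMul.algebraMap_injective R S
  haveI : CharP S p := charP_of_injective_algebraMap hinj p
  have hh : ∀ r : R, r ^ p ≠ h := by
    intro r hr
    apply hθ
    refine ⟨r, ?_⟩
    have h1 : (θ - algebraMap R S r) ^ p = 0 := by
      rw [sub_pow_char, hθh, ← map_pow, hr, sub_self]
    exact (sub_eq_zero.mp (pow_eq_zero_iff hp.ne_zero |>.mp h1)).symm
  set f : R[X] := X ^ p - C h with hf_def
  have hf : f.Monic := monic_X_pow_sub_C h hp.ne_zero
  haveI : IsDomain (AdjoinRoot f) := AdjoinRoot.isDomain_of_prime (prime_X_pow_sub_C_of_forall_pow_ne hp hh)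
  haveI : Module.Finite R (AdjoinRoot f) := hf.finite_adjoinRoot
  haveI : Algebra.IsIntegral R (AdjoinRoot f) := inferInstance
  have hfs : aeval θ f = 0 := by
    rw [hf_def, map_sub, aeval_X_pow, aeval_C, hθh, sub_self]
  let φ : AdjoinRoot f →ₐ[R] S := AdjoinRoot.liftAlgHom f (Algebra.ofId R S) θ
    (by rw [Algebra.toRingHom_ofId, ← aeval_def]; exact hfs)
  have hφroot : φ (AdjoinRoot.root f) = θ := AdjoinRoot.liftAlgHom_root _ _ _ _
  -- `φ` is injective (incomparability)
  have hφ : Function.Injective φ := by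
    rw [← AlgHom.coe_toRingHom, RingHom.injective_iff_ker_eq_bot]
    refine Ideal.eq_bot_of_comap_eq_bot (R := R) ?_
    rw [RingHom.comap_ker, AlgHom.comp_algebraMap, ← RingHom.injective_iff_ker_eq_bot]
    exact hinj
  -- the cokernel is torsion
  have hnat : f.natDegree = p := by rw [hf_def]; exact natDegree_X_pow_sub_C
  set N : Submodule R S := LinearMap.range φ.toLinearMap with hN
  have htors : ∀ x : S, ∃ r : R, r ≠ 0 ∧ r • x ∈ N := by
    intro x
    let B := (AdjoinRoot.powerBasis' hf).basis
    have hdim : (AdjoinRoot.powerBasis' hf).dim = p := by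
      rw [AdjoinRoot.powerBasis'_dim, hnat]
    have hli : LinearIndependent R (φ.toLinearMap ∘ B) :=
      B.linearIndependent.map' φ.toLinearMap (LinearMap.ker_eq_bot.mpr hφ)
    have key : ¬ ∀ (c : R) (y : S), y ∈ Submodule.span R (Set.range (φ.toLinearMap ∘ B)) →
        c • x + y = 0 → c = 0 := by
      intro H
      have h1 := (LinearIndependent.finCons' x _ hli H).fintype_card_le_finrank
      rw [Fintype.card_fin, hrank, hdim] at h1
      omega
    push Not at key
    obtain ⟨c, y, hy, hcy, hc0⟩ := key
    have hy' : y ∈ N := by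
      refine (Submodule.span_le.mpr ?_) hy
      rintro _ ⟨i, rfl⟩
      exact ⟨B i, rfl⟩
    refine ⟨c, hc0, ?_⟩
    rw [eq_neg_of_add_eq_zero_left hcy]
    exact N.neg_mem hy'
  -- a uniform denominator
  obtain ⟨r₀, hr₀, hr₀N⟩ : ∃ r₀ : R, r₀ ≠ 0 ∧ ∀ x : S, r₀ • x ∈ N := by
    obtain ⟨n, v, hv⟩ := Module.Finite.exists_fin (R := R) (M := S)
    choose r hr hrN using fun i => htors (v i)
    refine ⟨∏ i, r i, Finset.prod_ne_zero_iff.mpr fun i _ => hr i, fun x => ?_⟩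
    have hx : x ∈ Submodule.span R (Set.range v) := by rw [hv]; exact Submodule.mem_top
    induction hx using Submodule.span_induction with
    | mem y hy =>
      obtain ⟨i, rfl⟩ := hy
      rw [← Finset.prod_erase_mul Finset.univ r (Finset.mem_univ i), mul_smul]
      exact N.smul_mem _ (hrN i)
    | zero => rw [smul_zero]; exact N.zero_mem
    | add y z _ _ hy hz => rw [smul_add]; exact N.add_mem hy hz
    | smul a y _ hy => rw [smul_comm]; exact N.smul_mem a hy
  -- `ψ : S → R[T]/(f)` with `φ ∘ ψ = r₀ •`
  have hφ' : Function.Injective φ.toLinearMap := hφ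
  let E := LinearEquiv.ofInjective φ.toLinearMap hφ'
  let m : S →ₗ[R] N := LinearMap.codRestrict N (r₀ • LinearMap.id) fun x => hr₀N x
  let ψ : S →ₗ[R] AdjoinRoot f := E.symm.toLinearMap ∘ₗ m
  have hψ : ∀ x : S, φ (ψ x) = r₀ • x := by
    intro x
    have h1 : E (E.symm (m x)) = m x := E.apply_symm_apply (m x)
    have h2 := congrArg Subtype.val h1
    rw [LinearEquiv.ofInjective_apply] at h2
    exact h2
  have hψmul : ∀ a b : S, ψ a * ψ b = r₀ • ψ (a * b) := by
    intro a b
    apply hφ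
    rw [map_mul, map_smul, hψ, hψ, hψ, smul_mul_smul_comm, mul_smul]
  -- the transported derivation
  obtain ⟨δ, hδ⟩ := exists_derivation_adjoinRoot f
    (by rw [hf_def]; exact derivative_X_pow_sub_C_eq_zero p h)
  have hδroot : δ (AdjoinRoot.root f) = 1 := by
    rw [← AdjoinRoot.mk_X, hδ, derivative_X, map_one]
  let d : S →ₗ[R] S := φ.toLinearMap ∘ₗ (δ : AdjoinRoot f →ₗ[R] AdjoinRoot f) ∘ₗ ψ
  have hd : ∀ x, d x = φ (δ (ψ x)) := fun x => rfl
  have hr₀S : algebraMap R S r₀ ≠ 0 := (map_ne_zero_iff _ hinj).mpr hr₀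
  have hleib : ∀ a b : S, d (a * b) = a • d b + b • d a := by
    intro a b
    apply mul_left_cancel₀ hr₀S
    have h1 : ψ a * δ (ψ b) + ψ b * δ (ψ a) = r₀ • δ (ψ (a * b)) := by
      have := δ.leibniz (ψ a) (ψ b)
      rw [hψmul, Derivation.map_smul, smul_eq_mul, smul_eq_mul] at this
      exact this.symm
    have h2 : φ (ψ a) * φ (δ (ψ b)) + φ (ψ b) * φ (δ (ψ a)) = r₀ • φ (δ (ψ (a * b))) := by
      have := congrArg φ h1
      rwa [map_add, map_mul, map_mul, map_smul] at this
    rw [hψ, hψ] at h2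
    rw [hd, hd, hd, ← Algebra.smul_def, ← h2, smul_eq_mul, smul_eq_mul, Algebra.smul_def,
      Algebra.smul_def]
    ring
  refine ⟨Derivation.mk' d hleib, ?_⟩
  show d θ ≠ 0
  rw [hd]
  have hψθ : ψ θ = r₀ • AdjoinRoot.root f := by
    apply hφ
    rw [hψ, map_smul, hφroot]
  rw [hψθ, Derivation.map_smul, hδroot, map_smul, map_one, Algebra.smul_def, mul_one]
  exact hr₀S

/-- **Saturation.** Dividing a non-zero `R`-derivation `D₀` of the UFD `S` by the gcd of its
values on an `R`-basis gives a derivation whose values on the basis have no common prime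
factor. [folklore] -/
theorem exists_saturated_derivation {R S : Type*} [CommRing R] [CommRing S] [IsDomain S]
    [UniqueFactorizationMonoid S] [Algebra R S] {n : ℕ} (e : Basis (Fin n) R S)
    (D₀ : Derivation R S S) (h0 : ∃ s, D₀ s ≠ 0) :
    ∃ D : Derivation R S S, ∀ π : S, Prime π → ∃ i, ¬ π ∣ D (e i) := by
  classical
  letI := Classical.arbitrary (NormalizedGCDMonoid S)
  haveI : Nonempty (Fin n) := by
    by_contra hne
    obtain ⟨s, hs⟩ := h0
    apply hs
    haveI : IsEmpty (Fin n) := not_nonempty_iff.mp hne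
    rw [← e.sum_repr s, Finset.univ_eq_empty, Finset.sum_empty, map_zero]
  obtain ⟨g, hg, hgcd⟩ := Finset.extract_gcd (fun i => D₀ (e i)) Finset.univ_nonempty
  set c := Finset.univ.gcd (fun i => D₀ (e i)) with hc_def
  have hc : c ≠ 0 := by
    intro hc
    rw [hc_def, Finset.gcd_eq_zero_iff] at hc
    obtain ⟨s, hs⟩ := h0
    apply hs
    rw [← e.sum_repr s, map_sum]
    exact Finset.sum_eq_zero fun i _ => by
      rw [Derivation.map_smul, hc i (Finset.mem_univ i), smul_zero]
  let L : S →ₗ[R] S := e.constr R g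
  have hL : ∀ i, L (e i) = g i := fun i => e.constr_basis R g i
  have hcL : ∀ s, c * L s = D₀ s := by
    have heq : LinearMap.mulLeft R c ∘ₗ L = (D₀ : S →ₗ[R] S) := by
      refine e.ext fun i => ?_
      rw [LinearMap.comp_apply, LinearMap.mulLeft_apply, hL, Derivation.coeFn_coe,
        hg i (Finset.mem_univ i)]
    intro s
    have := LinearMap.congr_fun heq s
    rwa [LinearMap.comp_apply, LinearMap.mulLeft_apply, Derivation.coeFn_coe] at this
  have hleib : ∀ a b : S, L (a * b) = a • L b + b • L a := by
    intro a b
    apply mul_left_cancel₀ hc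
    rw [hcL, Derivation.leibniz, smul_eq_mul, smul_eq_mul, smul_eq_mul, smul_eq_mul, mul_add,
      mul_left_comm c a, hcL, mul_left_comm c b, hcL]
  refine ⟨Derivation.mk' L hleib, fun π hπ => ?_⟩
  by_contra hall
  push Not at hall
  have hdvd : π ∣ Finset.univ.gcd g :=
    Finset.dvd_gcd fun i _ => by
      have := hall i
      rwa [Derivation.coe_mk', hL] at this
  rw [hgcd] at hdvd
  exact hπ.not_unit (isUnit_of_dvd_one hdvd)

end Literature.RingTheory.Derivation
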